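import Mathlib
import HarnessLib
import Literature.Analysis.FluidPDE.SuitableWeak
import Literature.Analysis.FluidPDE.SelfSimilar
import Literature.Analysis.FluidPDE.LocalTypeI
import Literature.Analysis.FluidPDE.SpaceTimeRescaling
import Literature.Analysis.FluidPDE.LocalTypeIScaling
import Literature.Analysis.FluidPDE.LocalTypeICongr
import Literature.Analysis.FluidPDE.LocalTypeILscGradient
import Literature.Analysis.FluidPDE.LocalTypeISlabProfile
import Literature.Analysis.FluidPDE.LocalTypeIReverseTools
import Literature.Analysis.FluidPDE.SlabTypeICompactness
import Summits.NavierStokesRegularity.NavierStokesRegularity.Theorems.RellichScarApexLocalisationSpherePersistence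
import Summits.NavierStokesRegularity.NavierStokesRegularity.Theorems.RellichScarApexLocalisationMovingCentrePersistence
import Summits.NavierStokesRegularity.NavierStokesRegularity.Theorems.RellichScarApexLocalisationParentChild
import Summits.NavierStokesRegularity.NavierStokesRegularity.Theorems.RellichScarApexLocalisationReductionV3
import Summits.NavierStokesRegularity.NavierStokesRegularity.Theorems.RellichScarApexLocalisationTightIsApex

/-!
# Tight profiles are apex, threshold as a parameter (line dissipation-quantum-tolerance v2,
# crux ApexLocalisation, stub `stub_tightIsApexKappa`)

The landed `stub_tightIsApex` (`…Theorems.RellichScarApexLocalisationTightIsApex`) proves "dissipation-tight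
⇒ apex" with the card's threshold `(9/4) e`; but the dissipation quantum at ALL scales already forces
`E(Q((0,0),r)) ≥ (2+2√2) e > (9/4) e` at an origin-singular profile (bands of log-length `log 2` tile
log-time along the `√2`-grid), so that regime is empty.  This file re-proves the same reduction with the
threshold as a PARAMETER `κ`: if one companion at distance `s` forces `E(Q((0,0),2s)) ≥ κ e` (the
accounting input, e.g. the sharp one with `κ = 3 + 5√2/2`), then an origin-singular continuous class
profile with `sup_r E(Q((0,0),r)) < κ e` is apex.  The proof is that of `stub_tightIsApex` verbatim
(`orbitDichotomy`, `parentSingular_of_imageLimit_of_tendsto`, `cknE_limit_oldOrigin_le`, translation,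
accounting), with its helpers imported.

References: D. Albritton, T. Barker, J. Math. Fluid Mech. 21 (2019) = arXiv:1811.00502, Lemma 2.2,
Prop. 2.3, §3 [AlbrittonBarker2019].
-/

set_option linter.dupNamespace false

namespace Summit.NavierStokesRegularity.NavierStokesRegularity.Theorems.RellichScarApexLocalisation

open MeasureTheory Set Function Metric Filter Topology TopologicalSpace
open scoped ENNReal NNReal
open Literature.Analysis Literature.Analysis.FluidPDE
open Summit.NavierStokesRegularity.NavierStokesRegularity.Theorems.ApexLocalisation.Negative.Translate

local notation "E³" => EuclideanSpace ℝ (Fin 3)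

/-! ### The stub -/

/-- **S6κ, TIGHT PROFILES ARE APEX — threshold as a parameter** (fed an accounting input with the same
constant `κ`, e.g. the sharp S4'(b) with `κ = 3 + 5√2/2`; `orbitDichotomy`: a non-apex continuous class profile
has shell-centred images converging to an origin-singular class-`(C,4I)` profile `v`; `v` is also
singular at the limit position `e₀` of the old origin (`parentSingular_of_imageLimit_of_tendsto`),
and the TIGHTNESS of `u` about its origin passes to `v` about `(0,e₀)` (`cknE_limit_oldOrigin_le`);
translating `e₀` to the origin, S4(b) with the quanta at `0` and at `−e₀` contradicts tightness):
an origin-singular continuous class-`(C,I)` profile with `sup_{r>0} E(Q((0,0),r)) < κ e`, `e` a band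
quantum at every singular point of every continuous class-`(C,4I)` profile, has the apex bound
`HasTypeIDecay C'` for some `C'` — whenever one companion at distance `s` forces `E(Q((0,0),2s)) ≥ κ e`.
(The landed `stub_tightIsApex` is the case `κ = 9/4`, whose regime turned out to be EMPTY: the quantum
floor alone is `(2+2√2) e > (9/4) e`.) [cite: AlbrittonBarker2019, Lemma 2.2, Prop. 2.3 and §3] -/
theorem stub_tightIsApexKappa (κ : ℝ)
    (hS4 : ∀ (G : ℝ → E³ → E³ →L[ℝ] E³) (e s : ℝ) (b : E³), 0 ≤ e → 0 < s → ‖b‖ = s →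
      (∀ ρ : ℝ, 0 < ρ → ENNReal.ofReal (e * ρ) ≤
        ∫⁻ z in parabolicCylinder (ρ / 2) ((-(ρ ^ 2 / 4) : ℝ), (0 : E³)),
          ENNReal.ofReal (frobeniusNormSq (G z.1 z.2))) →
      (∀ ρ : ℝ, 0 < ρ → ENNReal.ofReal (e * ρ) ≤
        ∫⁻ z in parabolicCylinder (ρ / 2) ((-(ρ ^ 2 / 4) : ℝ), b),
          ENNReal.ofReal (frobeniusNormSq (G z.1 z.2))) →
      ENNReal.ofReal (κ * e) ≤ cknE (2 * s) ((0 : ℝ), (0 : E³)) G) :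
    ∀ (C : ℝ) (I : ℝ≥0∞) (e : ℝ), I < ⊤ → 0 < e →
      (∀ (v : ℝ → E³ → E³) (q : ℝ → E³ → ℝ) (H : ℝ → E³ → E³ →L[ℝ] E³),
        IsSuitableWeakSolutionOn (slab E³ (Iio 0) isOpen_Iio) 1 0 v q →
        HasWeakSpatialGradientOn (slab E³ (Iio 0) isOpen_Iio) v H →
        typeIBound (Iio (0 : ℝ) ×ˢ univ) v q H ≤ 4 * I →
        HasTypeITimeDecay C v →
        ContinuousOn (uncurry v) (Iio (0 : ℝ) ×ˢ univ) →
        ∀ b : E³, IsBackwardSingularPoint v ((0 : ℝ), b) →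
        ∀ ρ : ℝ, 0 < ρ → ENNReal.ofReal (e * ρ) ≤
          ∫⁻ z in parabolicCylinder (ρ / 2) ((-(ρ ^ 2 / 4) : ℝ), b),
            ENNReal.ofReal (frobeniusNormSq (H z.1 z.2))) →
      ∀ (u : ℝ → E³ → E³) (p : ℝ → E³ → ℝ) (G : ℝ → E³ → E³ →L[ℝ] E³),
        IsSuitableWeakSolutionOn (slab E³ (Iio 0) isOpen_Iio) 1 0 u p →
        HasWeakSpatialGradientOn (slab E³ (Iio 0) isOpen_Iio) u G →
        typeIBound (Iio (0 : ℝ) ×ˢ univ) u p G ≤ I →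
        HasTypeITimeDecay C u →
        ContinuousOn (uncurry u) (Iio (0 : ℝ) ×ˢ univ) →
        IsBackwardSingularPoint u 0 →
        (⨆ (r : ℝ) (_ : 0 < r), cknE r ((0 : ℝ), (0 : E³)) G) < ENNReal.ofReal (κ * e) →
        ∃ C' : ℝ, HasTypeIDecay C' u := by
  intro C I e hI he hq u p G hsw hwg hIle hC hcont hsing htight
  rcases orbitDichotomy hI hsw hwg hIle hC hcont with hapex |
      ⟨lk, xk, v, q, H, hadm, hv, hvg, hvI, hvC, hvcont, hconv, hvsing⟩
  · exact hapex
  exfalso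
  -- ## the tightness level `T`
  set T : ℝ≥0∞ := ⨆ (r : ℝ) (_ : 0 < r), cknE r ((0 : ℝ), (0 : E³)) G with hTdef
  have hTlt : T < ENNReal.ofReal (κ * e) := htight
  have hTtop : T < ⊤ := hTlt.trans ENNReal.ofReal_lt_top
  have htightρ : ∀ ρ : ℝ, 0 < ρ → cknE ρ (0 : ℝ × E³) G ≤ T := fun ρ hρ =>
    le_iSup₂ (f := fun (r : ℝ) (_ : 0 < r) => cknE r ((0 : ℝ), (0 : E³)) G) ρ hρ
  -- ## a convergent subsequence of the old origins `y k = -x_k/λ_k`, `1 ≤ ‖y k‖ ≤ 2`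
  set y : ℕ → E³ := fun k => -((lk k)⁻¹ • xk k) with hy
  have hynorm : ∀ k, ‖y k‖ = ‖xk k‖ / lk k := fun k => by
    rw [hy]
    simp only [norm_neg, norm_smul, norm_inv, Real.norm_of_nonneg (hadm k).1.le]
    rw [div_eq_inv_mul]
  have hy1 : ∀ k, 1 ≤ ‖y k‖ := fun k => by
    rw [hynorm, le_div_iff₀ (hadm k).1, one_mul]
    exact (hadm k).2.1
  have hy2 : ∀ k, ‖y k‖ ≤ 2 := fun k => by
    rw [hynorm, div_le_iff₀ (hadm k).1]
    exact (hadm k).2.2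
  obtain ⟨e₀, he₀, φ, hφ, hye⟩ : ∃ e₀ ∈ closedBall (0 : E³) 2, ∃ φ : ℕ → ℕ, StrictMono φ ∧
      Tendsto (y ∘ φ) atTop (𝓝 e₀) :=
    (isCompact_closedBall (0 : E³) 2).tendsto_subseq fun k => by
      rw [mem_closedBall, dist_zero_right]; exact hy2 k
  have he₀1 : 1 ≤ ‖e₀‖ := ge_of_tendsto hye.norm (Eventually.of_forall fun k => hy1 (φ k))
  have hs : 0 < ‖e₀‖ := lt_of_lt_of_le one_pos he₀1
  -- ## data along `φ`
  have hlk' : ∀ k, 0 < lk (φ k) := fun k => (hadm (φ k)).1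
  have hconv' : ∀ R : ℝ, 0 < R → Tendsto (fun k => eLpNorm
      (uncurry (lk (φ k) • stPull (lk (φ k) ^ 2) (lk (φ k)) 0 (xk (φ k)) u) - uncurry v) 3
      (volume.restrict (parabolicCylinder R (0 : ℝ × E³)))) atTop (𝓝 0) := fun R hR =>
    (hconv R hR).comp hφ.tendsto_atTop
  have hye' : Tendsto (fun k => -((lk (φ k))⁻¹ • xk (φ k))) atTop (𝓝 e₀) := hye
  -- ## the limit is singular at `(0, e₀)` (parent–child) and tight about it (lsc)
  have hsingE : IsBackwardSingularPoint v ((0 : ℝ), e₀) :=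
    parentSingular_of_imageLimit_of_tendsto hI hsw hwg hIle hC hcont hsing hlk' hv hconv' hye'
  have h4I : 4 * I < ⊤ := ENNReal.mul_lt_top (by simp) hI
  have hfin : ∀ r : ℝ, 0 < r →
      ∫⁻ w in parabolicCylinder r ((0 : ℝ), e₀), ENNReal.ofReal (frobeniusNormSq (H w.1 w.2)) < ⊤ := by
    intro r hr
    have h1 : cknE r ((0 : ℝ), e₀) H ≤ 4 * I :=
      (cknE_le_abScaledSum.trans (abScaledSum_le_typeIBound hr
        (parabolicCylinder_subset_lowerHalf le_rfl r))).trans hvI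
    rw [setLIntegral_frobenius_eq_mul_cknE hr]
    exact ENNReal.mul_lt_top ENNReal.ofReal_lt_top (lt_of_le_of_lt h1 h4I)
  have hTv : ∀ r : ℝ, 0 < r → cknE r ((0 : ℝ), e₀) H ≤ T :=
    cknE_limit_oldOrigin_le hsw hwg hIle hC hcont hlk' hvg hfin hconv' hye' hTtop htightρ
  -- ## translate `e₀` to the origin: two singular points with quanta, tight about the origin
  set w : ℝ → E³ → E³ := translate e₀ v with hw
  set qw : ℝ → E³ → ℝ := translate e₀ q with hqw
  set Hw : ℝ → E³ → E³ →L[ℝ] E³ := translate e₀ H with hHw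
  have hsw_w : IsSuitableWeakSolutionOn (slab E³ (Iio 0) isOpen_Iio) 1 0 w qw :=
    isSuitableWeakSolutionOn_translate hv e₀
  have hwg_w : HasWeakSpatialGradientOn (slab E³ (Iio 0) isOpen_Iio) w Hw :=
    hasWeakSpatialGradientOn_translate hvg e₀
  have hI_w : typeIBound (Iio (0 : ℝ) ×ˢ univ) w qw Hw ≤ 4 * I := by
    rw [hw, hqw, hHw, typeIBound_translate]
    exact hvI
  have hC_w : HasTypeITimeDecay C w := hasTypeITimeDecay_translate hvC e₀
  have hcont_w : ContinuousOn (uncurry w) (Iio (0 : ℝ) ×ˢ univ) := by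
    rw [hw, uncurry_translate]
    refine hvcont.comp (by fun_prop) fun z hz => ⟨hz.1, mem_univ _⟩
  have hsing_w0 : IsBackwardSingularPoint w 0 := (isBackwardSingularPoint_translate_iff e₀ v).2 hsingE
  have hsing_w1 : IsBackwardSingularPoint w ((0 : ℝ), -e₀) := by
    have hback : translate (-e₀) w = v := by
      funext t x
      show v t (e₀ + (-e₀ + x)) = v t x
      rw [← add_assoc, add_neg_cancel, zero_add]
    rw [← isBackwardSingularPoint_translate_iff (-e₀) w, hback]
    exact hvsing
  have hq0 := hq w qw Hw hsw_w hwg_w hI_w hC_w hcont_w 0 hsing_w0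
  have hq1 := hq w qw Hw hsw_w hwg_w hI_w hC_w hcont_w (-e₀) hsing_w1
  -- ## accounting: `κ e ≤ E(w; Q(0, 2‖e₀‖)) = E(v; Q((0,e₀), 2‖e₀‖)) ≤ T < κ e`
  have hacc : ENNReal.ofReal (κ * e) ≤ cknE (2 * ‖e₀‖) ((0 : ℝ), (0 : E³)) Hw :=
    hS4 Hw e ‖e₀‖ (-e₀) he.le hs (norm_neg e₀) hq0 hq1
  have hE : cknE (2 * ‖e₀‖) ((0 : ℝ), (0 : E³)) Hw = cknE (2 * ‖e₀‖) ((0 : ℝ), e₀) H := by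
    have h := cknE_nsZoom one_pos (by positivity : (0 : ℝ) < 2 * ‖e₀‖) 0 e₀ (0 : ℝ × E³) H
    rw [translate_G_eq, one_mul] at h
    have h0 : stAffine (1 ^ 2) 1 0 e₀ (0 : ℝ × E³) = ((0 : ℝ), e₀) := by
      simp [stAffine]
    rw [h0] at h
    rw [hHw]
    exact h
  have hle : ENNReal.ofReal (κ * e) ≤ T :=
    hacc.trans (hE.le.trans (hTv (2 * ‖e₀‖) (by positivity)))
  exact absurd hTlt (not_lt.2 hle)

end Summit.NavierStokesRegularity.NavierStokesRegularity.Theorems.RellichScarApexLocalisation
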